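import Summits.CriticalPhenomena.PercolationContinuityZ3.Theses.PercLowPointHalfSpace
import Summits.CriticalPhenomena.PercolationContinuityZ3.Theorems.TallClusterMassBound.Negative.MassExponentFamily
import Summits.CriticalPhenomena.PercolationContinuityZ3.Theorems.TallClusterMassBound.Negative.FalseWithoutCriticality
import Literature.Probability.Percolation.SharpnessDCTProofs
import Literature.Probability.Percolation.ConnectivityThetaSqProofs
import Literature.Probability.Percolation.TwoPointFunction

/-!
# Crux-triage r1, triager 2 (gen 2) — Lean evidence for `TallClusterMassBound` (stmt-CriticalPhenomena-0912)

Kernel-checked facts behind the verdicts in `TRIAGE-r1-2.md` (round 1, triager 2 of 3, generation 2).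
Nothing here asserts a Theses decl unconditionally; every `theorem` is an implication or an identity.

* §1 COSTUME CHECKS. `summit_of_sqrtSusceptibilityBound` : hypothesis (i) of card
  `gladkov-schur-second-moment-transfer` (`Ξ(n) = Σ_{B_n} √τ_{p_c} ≤ C n^{11/4-μ}`, `μ ≥ 0`) proves the summit
  conjunct `PercolationContinuityZ3` by itself (`√τ ≥ θ`); `summit_of_oneArmQuarter` : the residual
  `OneArmQuarter` of card `quarter-arm-transfer` (`P_{p_c}(0 ↔ ∂B_n) ≤ C n^{-1/4-ε}`) does too (`θ ≤ P(0 ↔ ∂B_n)`).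
* §2 REPLICA OVERLAP. `uncond_forces_wallArm_lower` / `tsb_forces_wallArm_lower` : the transferred statements
  B′ / TSB of card `replica-overlap-cs-transfer` silently contain a polynomial LOWER bound on the wall one-arm
  (`1 ≤ C r^{11/4} π_s(r)`, resp. `1 ≤ C r^{5/2} π_s(r)²`), read off the root summand `x = 0`; the crux itself does
  not (`crux_root_summand`). Sharpened transfer keeping the conditioning: `CondSurfaceBubble` (conditional replica
  overlap) with `csb_implies_crux : CondSurfaceBubble → TallClusterMassBound` and `tsb_implies_csb`.
* §3 ACCESSIBLE SKELETON. `acc_zero` (the root is accessible) and `accessibleMassBound_of_twoSided` : the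
  unconditional skeleton bound `Σ_{B_r} P(acc x) ≤ C r^{3-2a}` yields the card's ratio-form `AccessibleMassBound`
  only together with a wall one-arm LOWER bound of exponent `b` with `b + 1/4 ≤ 2a` (two-sided control, not crux C
  as filed); `accessibleMassBound_of_crux`, `overhangMassBound_of_crux` : both stubs are implied by B, so with the card's
  split lemma the decomposition B ⟺ (skeleton ∧ overhang) is exact — no truth-content is gained or lost.
-/

noncomputable section

open MeasureTheory Filter
open Literature.Probability.Percolation Literature.Probability.LatticeModels
open Summit.CriticalPhenomena.PercolationContinuityZ3.Theses.PercLowPointHalfSpace (TallClusterMassBound)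
open Summit.CriticalPhenomena.PercolationContinuityZ3.Theorems.TallClusterMassBound.Negative

namespace Summit.CriticalPhenomena.PercolationContinuityZ3.Cruxes.TallClusterMassBound.Triage2

/-! ## §1 Costume checks: two transferred hypotheses close the SUMMIT by themselves -/

/-- `Ξ(n) = Σ_{z ∈ B_n} √τ_{p_c}(0,z)` (card gladkov-schur's `sqrtSusc`). [folklore] -/
def sqrtSusc (n : ℕ) : ℝ := ∑ z ∈ box 3 n, Real.sqrt (tau 3 (criticalProbI 3) 0 z)

/-- Hypothesis (i) of card gladkov-schur: `Ξ(n) ≤ C n^{11/4 - μ}` for all `n ≥ 1`. [folklore] -/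
def SqrtSusceptibilityBound (μ C : ℝ) : Prop :=
  ∀ n : ℕ, 1 ≤ n → sqrtSusc n ≤ C * (n : ℝ) ^ ((11 : ℝ) / 4 - μ)

/-- `θ(p_c) · (2n+1)³ ≤ Ξ(n)`, from `θ² ≤ τ(0,z)` (tree: `Grimmett1999_theta_sq_le_openConn_holds`). [folklore] -/
theorem theta_mul_card_le_sqrtSusc (n : ℕ) :
    theta (zdGraph 3) 0 (criticalProbI 3) * (2 * (n : ℝ) + 1) ^ 3 ≤ sqrtSusc n := by
  have hθ : 0 ≤ theta (zdGraph 3) (0 : Site 3) (criticalProbI 3) := measureReal_nonneg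
  have h : ∀ z : Site 3, theta (zdGraph 3) 0 (criticalProbI 3) ≤ Real.sqrt (tau 3 (criticalProbI 3) 0 z) := by
    intro z
    have h2 := Grimmett1999_theta_sq_le_openConn_holds 3 (criticalProbI 3) 0 z
    rw [← tau_def] at h2
    calc theta (zdGraph 3) 0 (criticalProbI 3)
        = Real.sqrt (theta (zdGraph 3) 0 (criticalProbI 3) ^ 2) := by rw [Real.sqrt_sq hθ]
      _ ≤ Real.sqrt (tau 3 (criticalProbI 3) 0 z) := Real.sqrt_le_sqrt h2
  calc theta (zdGraph 3) 0 (criticalProbI 3) * (2 * (n : ℝ) + 1) ^ 3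
      = ∑ _z ∈ box 3 n, theta (zdGraph 3) 0 (criticalProbI 3) := by
        rw [Finset.sum_const, nsmul_eq_mul, card_box]; push_cast; ring
    _ ≤ sqrtSusc n := Finset.sum_le_sum fun z _ => h z

/-- COSTUME CHECK 1: hypothesis (i) of card gladkov-schur (any `μ ≥ 0`) proves the summit conjunct
`PercolationContinuityZ3` in three lines — so a line resting on (i) bypasses route PercLowPointHalfSpace. [folklore] -/
theorem summit_of_sqrtSusceptibilityBound {μ C : ℝ} (hμ : 0 ≤ μ) (h : SqrtSusceptibilityBound μ C) :
    _root_.PercolationContinuityZ3 := by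
  rw [_root_.PercolationContinuityZ3, Literature.Probability.Percolation.PercolationContinuityZ3,
    PercolationContinuity]
  set θ : ℝ := theta (zdGraph 3) (0 : Site 3) (criticalProbI 3) with hθdef
  have hθ0 : 0 ≤ θ := measureReal_nonneg
  by_contra hne
  have hθpos : 0 < θ := lt_of_le_of_ne hθ0 (Ne.symm hne)
  have hs : (11 : ℝ) / 4 - μ < 3 := by linarith
  refine not_forall_rpow_le (c := θ) (C := C) (s := (11 : ℝ) / 4 - μ) (t := 3) hθpos hs fun n hn => ?_
  have h1 := (theta_mul_card_le_sqrtSusc n).trans (h n hn)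
  have hn' : (1 : ℝ) ≤ n := by exact_mod_cast hn
  have h3 : (n : ℝ) ^ (3 : ℝ) = (n : ℝ) ^ (3 : ℕ) := by exact_mod_cast Real.rpow_natCast (n : ℝ) 3
  have hle : (n : ℝ) ^ (3 : ℕ) ≤ (2 * (n : ℝ) + 1) ^ 3 := pow_le_pow_left₀ (by linarith) (by linarith) 3
  rw [h3]
  calc θ * (n : ℝ) ^ (3 : ℕ) ≤ θ * (2 * (n : ℝ) + 1) ^ 3 := mul_le_mul_of_nonneg_left hle hθ0
    _ ≤ C * (n : ℝ) ^ ((11 : ℝ) / 4 - μ) := h1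

/-- The residual of card quarter-arm-transfer: a bulk one-arm rate `1/4 + ε` at `p_c(ℤ³)`. [folklore] -/
def OneArmQuarter (ε C : ℝ) : Prop :=
  ∀ n : ℕ, 1 ≤ n →
    (bondPercolation (zdGraph 3) (criticalProbI 3)).real (siteToBoundary 3 n) ≤ C * (n : ℝ) ^ (-(1 / 4 + ε))

/-- COSTUME CHECK 2: `OneArmQuarter` (any `ε ≥ 0`) proves the summit conjunct by itself
(`θ ≤ P(0 ↔ ∂B_n) → 0`, tree `DCT16.theta_le_real_siteToBoundary`). [folklore] -/
theorem summit_of_oneArmQuarter {ε C : ℝ} (hε : 0 ≤ ε) (h : OneArmQuarter ε C) :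
    _root_.PercolationContinuityZ3 := by
  rw [_root_.PercolationContinuityZ3, Literature.Probability.Percolation.PercolationContinuityZ3,
    PercolationContinuity]
  refine le_antisymm ?_ measureReal_nonneg
  have ha : 0 < 1 / 4 + ε := by linarith
  have hlim : Tendsto (fun n : ℕ => C * (n : ℝ) ^ (-(1 / 4 + ε))) atTop (nhds 0) := by
    have h1 : Tendsto (fun n : ℕ => (n : ℝ) ^ (-(1 / 4 + ε))) atTop (nhds 0) :=
      (tendsto_rpow_neg_atTop ha).comp tendsto_natCast_atTop_atTop
    simpa using h1.const_mul C
  refine ge_of_tendsto hlim ?_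
  filter_upwards [eventually_ge_atTop 1] with n hn
  exact (DCT16.theta_le_real_siteToBoundary (d := 3) (criticalProbI 3) n).trans (h n hn)

/-! ## §2 Replica overlap: the hidden root term, and the sharpened (conditional) transfer -/

/-- Shorthand: the critical parameter. [folklore] -/
abbrev pc : unitInterval := criticalProbI 3

/-- B′ of card replica-overlap (drop the conditioning): `Σ_{B_r} P(0 ↔_ℍ x) ≤ C r^{11/4} π_s(r)`. [folklore] -/
def UncondMassBound : Prop :=
  ∃ C : ℝ, ∀ r : ℕ, 1 ≤ r → ∑ x ∈ box 3 r, (Pp pc).real (conn x) ≤ C * (r : ℝ) ^ ((11 : ℝ) / 4) * armProb pc r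

/-- TSB of card replica-overlap (replica overlap): `Σ_{B_r} P(0 ↔_ℍ x)² ≤ C r^{5/2} π_s(r)²`. [folklore] -/
def TruncatedSurfaceBubble : Prop :=
  ∃ C : ℝ, ∀ r : ℕ, 1 ≤ r →
    ∑ x ∈ box 3 r, ((Pp pc).real (conn x)) ^ 2 ≤ C * (r : ℝ) ^ ((5 : ℝ) / 2) * (armProb pc r) ^ 2

/-- HIDDEN CONTENT OF B′: its root summand `x = 0` (`P(0 ↔_ℍ 0) = 1`) forces the wall one-arm LOWER bound
`1 ≤ C r^{11/4} π_s(r)` (`x_s ≤ 11/4`), which is not part of the crux. [folklore] -/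
theorem uncond_forces_wallArm_lower (h : UncondMassBound) :
    ∃ C : ℝ, ∀ r : ℕ, 1 ≤ r → 1 ≤ C * (r : ℝ) ^ ((11 : ℝ) / 4) * armProb pc r := by
  obtain ⟨C, hC⟩ := h
  refine ⟨C, fun r hr => le_trans ?_ (hC r hr)⟩
  have h0 : (Pp pc).real (conn 0) = 1 := by rw [conn_zero]; exact probReal_univ
  calc (1 : ℝ) = (Pp pc).real (conn 0) := h0.symm
    _ ≤ ∑ x ∈ box 3 r, (Pp pc).real (conn x) :=
        Finset.single_le_sum (fun x _ => measureReal_nonneg) (zero_mem_box 3 r)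

/-- HIDDEN CONTENT OF TSB: its root summand forces `1 ≤ C r^{5/2} π_s(r)²` (`x_s ≤ 5/4`). [folklore] -/
theorem tsb_forces_wallArm_lower (h : TruncatedSurfaceBubble) :
    ∃ C : ℝ, ∀ r : ℕ, 1 ≤ r → 1 ≤ C * (r : ℝ) ^ ((5 : ℝ) / 2) * (armProb pc r) ^ 2 := by
  obtain ⟨C, hC⟩ := h
  refine ⟨C, fun r hr => le_trans ?_ (hC r hr)⟩
  have h0 : (Pp pc).real (conn 0) = 1 := by rw [conn_zero]; exact probReal_univ
  calc (1 : ℝ) = ((Pp pc).real (conn 0)) ^ 2 := by rw [h0]; norm_num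
    _ ≤ ∑ x ∈ box 3 r, ((Pp pc).real (conn x)) ^ 2 :=
        Finset.single_le_sum (f := fun x => ((Pp pc).real (conn x)) ^ 2) (fun x _ => sq_nonneg _)
          (zero_mem_box 3 r)

/-- By contrast the crux's own root summand is harmless: `P(0 ↔_ℍ 0, arm_r) = π_s(r)`. [folklore] -/
theorem crux_root_summand (r : ℕ) : (Pp pc).real (conn 0 ∩ arm r) = armProb pc r := by
  rw [conn_zero, Set.univ_inter]; rfl

/-- SHARPENED TRANSFER (keeps the conditioning): the CONDITIONAL replica overlap
`CSB : Σ_{B_r} P(0 ↔_ℍ x, arm_r)² = E[|U ∩ U′ ∩ B_r| ; U, U′ tall] ≤ C r^{5/2} π_s(r)²`. [folklore] -/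
def CondSurfaceBubble : Prop :=
  ∃ C : ℝ, ∀ r : ℕ, 1 ≤ r →
    ∑ x ∈ box 3 r, ((Pp pc).real (conn x ∩ arm r)) ^ 2 ≤ C * (r : ℝ) ^ ((5 : ℝ) / 2) * (armProb pc r) ^ 2

/-- TSB ⟹ CSB (termwise `P(A ∩ T) ≤ P(A)`): CSB is the weaker statement. [folklore] -/
theorem tsb_implies_csb (h : TruncatedSurfaceBubble) : CondSurfaceBubble := by
  obtain ⟨C, hC⟩ := h
  refine ⟨C, fun r hr => le_trans (Finset.sum_le_sum fun x _ => ?_) (hC r hr)⟩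
  exact pow_le_pow_left₀ measureReal_nonneg (measureReal_mono Set.inter_subset_left) 2

/-- CSB ⟹ the crux, by Cauchy–Schwarz over the `(2r+1)³ ≤ 27 r³` points of the box (same algebra as the card's
`tsb_implies_uncond`, with the conditioning kept inside). [folklore] -/
theorem csb_implies_crux (h : CondSurfaceBubble) : TallClusterMassBound := by
  rw [tallClusterMassBound_iff]
  obtain ⟨C, hC⟩ := h
  refine ⟨Real.sqrt (27 * max C 0), fun r hr => ?_⟩
  have hr0 : (0 : ℝ) < r := by exact_mod_cast hr
  set P : ℝ := armProb pc r with hP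
  set A : ℝ := ∑ x ∈ box 3 r, (Pp pc).real (conn x ∩ arm r) with hA
  have hA0 : 0 ≤ A := Finset.sum_nonneg fun x _ => measureReal_nonneg
  have hP0 : 0 ≤ P := measureReal_nonneg
  have hCS : A ^ 2 ≤ (∑ x ∈ box 3 r, ((Pp pc).real (conn x ∩ arm r)) ^ 2) * ((box 3 r).card : ℝ) := by
    have h := Finset.sum_mul_sq_le_sq_mul_sq (box 3 r) (fun x => (Pp pc).real (conn x ∩ arm r))
      (fun _ => (1 : ℝ))
    simpa [hA] using h
  have hcard : ((box 3 r).card : ℝ) ≤ 27 * (r : ℝ) ^ 3 := by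
    rw [card_box]
    push_cast
    have h1 : (1 : ℝ) ≤ r := by exact_mod_cast hr
    nlinarith [h1, sq_nonneg ((r : ℝ) - 1), mul_pos hr0 hr0]
  have hmax : 0 ≤ max C 0 := le_max_right _ _
  have hsum : ∑ x ∈ box 3 r, ((Pp pc).real (conn x ∩ arm r)) ^ 2 ≤ max C 0 * (r : ℝ) ^ ((5 : ℝ) / 2) * P ^ 2 := by
    refine le_trans (hC r hr) ?_
    have : C ≤ max C 0 := le_max_left _ _
    have hnn : 0 ≤ (r : ℝ) ^ ((5 : ℝ) / 2) * P ^ 2 := by positivity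
    nlinarith [mul_le_mul_of_nonneg_right this hnn]
  have h3 : (r : ℝ) ^ (3 : ℝ) = (r : ℝ) ^ 3 := by
    rw [show (3 : ℝ) = ((3 : ℕ) : ℝ) by norm_num, Real.rpow_natCast]
  have hpow : ((r : ℝ) ^ ((11 : ℝ) / 4)) ^ 2 = (r : ℝ) ^ ((5 : ℝ) / 2) * (r : ℝ) ^ 3 := by
    rw [← h3, ← Real.rpow_add hr0, ← Real.rpow_natCast, ← Real.rpow_mul hr0.le]
    congr 1
    push_cast
    norm_num
  have hsq : (Real.sqrt (27 * max C 0)) ^ 2 = 27 * max C 0 := Real.sq_sqrt (by positivity)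
  have hB : A ^ 2 ≤ (Real.sqrt (27 * max C 0) * (r : ℝ) ^ ((11 : ℝ) / 4) * P) ^ 2 := by
    calc A ^ 2 ≤ (∑ x ∈ box 3 r, ((Pp pc).real (conn x ∩ arm r)) ^ 2) * ((box 3 r).card : ℝ) := hCS
      _ ≤ (max C 0 * (r : ℝ) ^ ((5 : ℝ) / 2) * P ^ 2) * (27 * (r : ℝ) ^ 3) :=
          mul_le_mul hsum hcard (by positivity) (mul_nonneg (mul_nonneg hmax (by positivity)) (sq_nonneg _))
      _ = (Real.sqrt (27 * max C 0) * (r : ℝ) ^ ((11 : ℝ) / 4) * P) ^ 2 := by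
          rw [mul_pow, mul_pow, hsq, hpow]; ring
  have hBnonneg : 0 ≤ Real.sqrt (27 * max C 0) * (r : ℝ) ^ ((11 : ℝ) / 4) * P := by positivity
  have := (pow_le_pow_iff_left₀ hA0 hBnonneg (by norm_num : (2 : ℕ) ≠ 0)).1 hB
  simpa [mass, hA, hP] using this

/-! ## §3 Accessible skeleton: the ratio form needs TWO-sided wall control -/

/-- The slab `{0 ≤ y₀ ≤ h}`. [folklore] -/
abbrev slabTo (h : ℤ) : Set V3 := {y : V3 | 0 ≤ y 0 ∧ y 0 ≤ h}

/-- `x` is monotone-accessible: `0 ↔ x` inside the slab `{0 ≤ y₀ ≤ x₀}` (card accessible-skeleton's `acc`). [folklore] -/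
abbrev acc (x : V3) : Set (BondConfig V3) := openConnIn (slabTo (x 0)) 0 x

/-- The card's ratio-form skeleton bound (with the conditioning on `arm r` kept). [folklore] -/
def AccessibleMassBound : Prop :=
  ∃ C : ℝ, ∀ r : ℕ, 1 ≤ r →
    ∑ x ∈ box 3 r, (Pp pc).real (acc x ∩ arm r) ≤ C * (r : ℝ) ^ ((11 : ℝ) / 4) * armProb pc r

/-- The UNCONDITIONAL skeleton bound the card can prove from a wall one-arm rate `a` (conclusion of its
`AccessibleFromBoundaryRate`): `Σ_{B_r} P(acc x) ≤ C r^{3-2a}`. [folklore] -/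
def SkeletonUncond (a C : ℝ) : Prop :=
  ∀ r : ℕ, 1 ≤ r → ∑ x ∈ box 3 r, (Pp pc).real (acc x) ≤ C * (r : ℝ) ^ (3 - 2 * a)

/-- A polynomial LOWER bound for the wall one-arm: `c r^{-b} ≤ π_s(r)`, `c > 0`. [folklore] -/
def WallArmLower (b c : ℝ) : Prop :=
  0 < c ∧ ∀ r : ℕ, 1 ≤ r → c * (r : ℝ) ^ (-b) ≤ armProb pc r

/-- The root is accessible: `acc 0` is the sure event. [folklore] -/
theorem acc_zero : acc 0 = Set.univ := by
  ext ω
  simp only [Set.mem_univ, iff_true]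
  have h0 : (0 : V3) ∈ slabTo ((0 : V3) 0) := by simp
  change ω ∈ openConnIn (slabTo ((0 : V3) 0)) 0 0
  rw [openConnIn_eq_openConnVia h0]
  exact mem_openClusterIn_iff.2 SimpleGraph.Reachable.rfl

/-- Hence the unconditional skeleton sum is `≥ 1`: `SkeletonUncond a C` alone says nothing unless `3 - 2a ≥ 0`
is matched against `π_s`; in particular it needs `C ≥ 1`. [folklore] -/
theorem one_le_skeleton_sum (r : ℕ) : 1 ≤ ∑ x ∈ box 3 r, (Pp pc).real (acc x) := by
  have h0 : (Pp pc).real (acc 0) = 1 := by rw [acc_zero]; exact probReal_univ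
  calc (1 : ℝ) = (Pp pc).real (acc 0) := h0.symm
    _ ≤ ∑ x ∈ box 3 r, (Pp pc).real (acc x) :=
        Finset.single_le_sum (fun x _ => measureReal_nonneg) (zero_mem_box 3 r)

/-- TWO-SIDED TRANSFER: the unconditional skeleton bound with rate `a` plus a wall one-arm LOWER bound with
exponent `b` give the ratio-form `AccessibleMassBound` as soon as `b + 1/4 ≤ 2a`. (With only crux C as filed —
some rate `a > 0`, no lower bound — nothing follows.) [folklore] -/
theorem accessibleMassBound_of_twoSided {a b C c : ℝ} (hS : SkeletonUncond a C) (hL : WallArmLower b c)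
    (hab : b + 1 / 4 ≤ 2 * a) : AccessibleMassBound := by
  obtain ⟨hc, hL⟩ := hL
  refine ⟨max C 0 / c, fun r hr => ?_⟩
  have hr0 : (0 : ℝ) < r := by exact_mod_cast hr
  have hr1 : (1 : ℝ) ≤ r := by exact_mod_cast hr
  have hπ := hL r hr
  have hmax : 0 ≤ max C 0 := le_max_right _ _
  -- drop the conditioning, apply the skeleton bound
  have h1 : ∑ x ∈ box 3 r, (Pp pc).real (acc x ∩ arm r) ≤ max C 0 * (r : ℝ) ^ (3 - 2 * a) := by
    calc ∑ x ∈ box 3 r, (Pp pc).real (acc x ∩ arm r) ≤ ∑ x ∈ box 3 r, (Pp pc).real (acc x) :=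
          Finset.sum_le_sum fun x _ => measureReal_mono Set.inter_subset_left
      _ ≤ C * (r : ℝ) ^ (3 - 2 * a) := hS r hr
      _ ≤ max C 0 * (r : ℝ) ^ (3 - 2 * a) :=
          mul_le_mul_of_nonneg_right (le_max_left _ _) (Real.rpow_nonneg hr0.le _)
  -- compare exponents: r^{3-2a} ≤ r^{11/4} · r^{-b}
  have h2 : (r : ℝ) ^ (3 - 2 * a) ≤ (r : ℝ) ^ ((11 : ℝ) / 4) * (r : ℝ) ^ (-b) := by
    rw [← Real.rpow_add hr0]
    exact Real.rpow_le_rpow_of_exponent_le hr1 (by linarith)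
  have h3 : max C 0 * (r : ℝ) ^ (3 - 2 * a) ≤ max C 0 / c * (r : ℝ) ^ ((11 : ℝ) / 4) * (c * (r : ℝ) ^ (-b)) := by
    have : max C 0 / c * (r : ℝ) ^ ((11 : ℝ) / 4) * (c * (r : ℝ) ^ (-b)) =
        max C 0 * ((r : ℝ) ^ ((11 : ℝ) / 4) * (r : ℝ) ^ (-b)) := by
      field_simp
    rw [this]
    exact mul_le_mul_of_nonneg_left h2 hmax
  have h4 : max C 0 / c * (r : ℝ) ^ ((11 : ℝ) / 4) * (c * (r : ℝ) ^ (-b)) ≤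
      max C 0 / c * (r : ℝ) ^ ((11 : ℝ) / 4) * armProb pc r :=
    mul_le_mul_of_nonneg_left hπ (mul_nonneg (div_nonneg hmax hc.le) (Real.rpow_nonneg hr0.le _))
  exact h1.trans (h3.trans h4)

/-! ### The split is lossless: both stubs of card accessible-skeleton are NECESSARY (each is implied by B) -/

/-- `acc x ⊆ conn x`: an open path inside the slab `{0 ≤ y₀ ≤ x₀}` lies inside `ℍ`. [folklore] -/
theorem acc_subset_conn (x : V3) : acc x ⊆ conn x := by
  rintro ω ⟨hx, hy, hr⟩
  have h : slabTo (x 0) ⊆ Hs := fun y hy => hy.1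
  change ω ∈ openConnIn Hs 0 x
  exact ⟨h hx, h hy, hr.map (SimpleGraph.induceHomOfLE (G := openGraph ω) h).toHom⟩

/-- The card's second stub: overhang points of the tall cluster (reached only above their own level). [folklore] -/
def OverhangMassBound : Prop :=
  ∃ C : ℝ, ∀ r : ℕ, 1 ≤ r →
    ∑ x ∈ box 3 r, (Pp pc).real ((conn x \ acc x) ∩ arm r) ≤ C * (r : ℝ) ^ ((11 : ℝ) / 4) * armProb pc r

/-- B ⟹ AccessibleMassBound (termwise `acc x ∩ arm ⊆ conn x ∩ arm`). [folklore] -/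
theorem accessibleMassBound_of_crux (h : TallClusterMassBound) : AccessibleMassBound := by
  rw [tallClusterMassBound_iff] at h
  obtain ⟨C, hC⟩ := h
  refine ⟨C, fun r hr => le_trans (Finset.sum_le_sum fun x _ => ?_) (hC r hr)⟩
  exact measureReal_mono (Set.inter_subset_inter_left _ (acc_subset_conn x))

/-- B ⟹ OverhangMassBound (termwise `(conn x ∖ acc x) ∩ arm ⊆ conn x ∩ arm`). So, with the card's PROVED split
`AccessibleMassBound → OverhangMassBound → B`, the decomposition is exact: B ⟺ (skeleton stub ∧ overhang stub). [folklore] -/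
theorem overhangMassBound_of_crux (h : TallClusterMassBound) : OverhangMassBound := by
  rw [tallClusterMassBound_iff] at h
  obtain ⟨C, hC⟩ := h
  refine ⟨C, fun r hr => le_trans (Finset.sum_le_sum fun x _ => ?_) (hC r hr)⟩
  exact measureReal_mono (Set.inter_subset_inter_left _ Set.sdiff_subset)

end Summit.CriticalPhenomena.PercolationContinuityZ3.Cruxes.TallClusterMassBound.Triage2
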